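import Summits.QuantumFields.YangMills.Theorems.SwapVirialDeficitSectorLaplaceEndGaussFloor
import Summits.QuantumFields.YangMills.Theorems.SwapVirialDeficitSectorLaplaceEndLeaderFubini
import HarnessLib

/-!
# GLUE for the hypothesis `hF` of ✓`lintegral_hubSlab_leader_le`: the block-letter density identity and the exponential form of ✓`endGauss_three_floor`
# (stub `stub_core_end`, target `stub_end_gaussCore` of LEAD sfw-p2 g99 22:32Z; free-hands support of ⟨stmt-QuantumFields-24197⟩ `SwapVirialDeficit.SwapGluedStiffness`)

The caller of ✓`lintegral_hubSlab_leader_le` proves `hF` at a leader point `(t 0, ((t 1, u), (t 2, v)), z)` in two moves; this file supplies both as named lemmas: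
* `bDensity_blocks_eq` — `((1+δ²)⁻¹)²·gnoDensity(x, y, z, F) = ((1+δ²)⁻¹)²·((1+t1²+|u|²)²)⁻¹·((1+t2²+|v|²)²)⁻¹·gnomonicWeight z·piWeight F` in block letters, and
  `bDensity_blocks_le` (drop `((1+δ²)⁻¹)² ≤ 1`, `piWeight ≤ 1`);
* ★ `endGauss_exp_three_floor` — for `δ² ≤ 1/3`, `|u|² ≤ 1 + x₀²`, `0 ≤ c` and ANY followers `F₀`:
  `exp(−(c·55200L⁶)·F̂(hubAt δ 1, ε, (ℓ, F₀))) ≤ exp(−c·B₀|u|²/(1+x₀²+|u|²))·exp(−c·|v|²/(1+y₀²+|v|²))·exp(−c·|z|²/(1+|z|²))` — the three factors of `hF` with `r = B₀`,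
  `c₁ = c₂ = c₃ = c` (take `F₀ = y⋆(ℓ)`, w2's follower minimiser, so that `m(ℓ) = F̂(ℓ, y⋆)`).

HONEST LABEL: bookkeeping; `stub_core_end` (target hG♭: follower half w2, matching∕assembly LEAD) and stubs core-tip ∕ 001-good, ⟨24197⟩ ∕ ⟨24194⟩ and every rung OPEN; own crux
⟨22884⟩ OPEN (blocked-on ⟨19935⟩); the Yang–Mills mass gap is NOT proved; no summit is proved by a line.  THEOREMS ONLY (0 `def`, 0 `sorry`), standard axioms.
Width seat ym-line-sfw-p2-w3 g67 (cell ym-idea-1, free hands), `--supports stmt-QuantumFields-24197`.  References: [folklore]; [cite: Luscher1983, §2].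
-/

set_option autoImplicit false

noncomputable section

open MeasureTheory Quaternion
open scoped BigOperators Quaternion
open Literature.MathematicalPhysics.QuantumFieldTheory hiding SU2
open Literature.MathematicalPhysics.QuantumLattice

namespace Summit.QuantumFields.YangMills.Theorems.SwapVirialDeficit.BlowUpRing

open Summit.QuantumFields.YangMills.Theorems.FemtoTransferGap
open Summit.QuantumFields.YangMills.Theorems.FemtoTransferGap.TT
open Summit.QuantumFields.YangMills.Theorems.VirialFluxGap.RingDeficit
open Summit.QuantumFields.YangMills.Theorems.SwapVirialDeficit.SwapRing
open Summit.QuantumFields.YangMills.Theorems.SwapVirialDeficit.Gnomonic (normSq3 gnomonicWeight piWeight gnomonicWeight_le_one piWeight_le_one piWeight_pos)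

variable {L : ℕ} [NeZero L]

/-- The B-density in block letters: `((1+δ²)⁻¹)²·gnoDensity((t1∷u),(t2∷v),z,F) = ((1+δ²)⁻¹)²·((1+t1²+|u|²)²)⁻¹·((1+t2²+|v|²)²)⁻¹·gnomonicWeight z·piWeight F`. [folklore] -/
theorem bDensity_blocks_eq (δ : ℝ) (u : ℝ × ℝ) (t : Fin 3 → ℝ) (v : Fin 2 → ℝ) (z : Fin 3 → ℝ) (F : Fol L → Fin 3 → ℝ) :
    ((1 + δ ^ 2)⁻¹) ^ 2 * gnoDensity ((((![t 1, u.1, u.2] : Fin 3 → ℝ), (![t 2, v 0, v 1] : Fin 3 → ℝ)), (z, F)) : GnoCoord L) =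
      ((1 + δ ^ 2)⁻¹) ^ 2 * (((1 + t 1 ^ 2 + (u.1 ^ 2 + u.2 ^ 2)) ^ 2)⁻¹ * (((1 + t 2 ^ 2 + (v 0 ^ 2 + v 1 ^ 2)) ^ 2)⁻¹ * (gnomonicWeight z * piWeight F))) := by
  have h1 : gnomonicWeight (![t 1, u.1, u.2] : Fin 3 → ℝ) = ((1 + t 1 ^ 2 + (u.1 ^ 2 + u.2 ^ 2)) ^ 2)⁻¹ := by
    rw [show gnomonicWeight (![t 1, u.1, u.2] : Fin 3 → ℝ) = ((1 + normSq3 (![t 1, u.1, u.2] : Fin 3 → ℝ))⁻¹) ^ 2 from rfl, SigmaBall.normSq3_vec3, inv_pow]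
    ring
  have h2 : gnomonicWeight (![t 2, v 0, v 1] : Fin 3 → ℝ) = ((1 + t 2 ^ 2 + (v 0 ^ 2 + v 1 ^ 2)) ^ 2)⁻¹ := by
    rw [show gnomonicWeight (![t 2, v 0, v 1] : Fin 3 → ℝ) = ((1 + normSq3 (![t 2, v 0, v 1] : Fin 3 → ℝ))⁻¹) ^ 2 from rfl, SigmaBall.normSq3_vec3, inv_pow]
    ring
  show ((1 + δ ^ 2)⁻¹) ^ 2 * (gnomonicWeight (![t 1, u.1, u.2] : Fin 3 → ℝ) * gnomonicWeight (![t 2, v 0, v 1] : Fin 3 → ℝ) * gnomonicWeight z * piWeight F) = _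
  rw [h1, h2]; ring

/-- … and its bound by the three one-block weights (`((1+δ²)⁻¹)² ≤ 1`, `piWeight ≤ 1`), in `ℝ≥0∞`. [folklore] -/
theorem bDensity_blocks_le (δ : ℝ) (u : ℝ × ℝ) (t : Fin 3 → ℝ) (v : Fin 2 → ℝ) (z : Fin 3 → ℝ) (F : Fol L → Fin 3 → ℝ) :
    ENNReal.ofReal (((1 + δ ^ 2)⁻¹) ^ 2 * gnoDensity ((((![t 1, u.1, u.2] : Fin 3 → ℝ), (![t 2, v 0, v 1] : Fin 3 → ℝ)), (z, F)) : GnoCoord L)) ≤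
      ENNReal.ofReal (((1 + t 1 ^ 2 + (u.1 ^ 2 + u.2 ^ 2)) ^ 2)⁻¹) * ENNReal.ofReal (((1 + t 2 ^ 2 + (v 0 ^ 2 + v 1 ^ 2)) ^ 2)⁻¹) * ENNReal.ofReal (gnomonicWeight z) := by
  have hA : 0 ≤ ((1 + t 1 ^ 2 + (u.1 ^ 2 + u.2 ^ 2)) ^ 2)⁻¹ := by positivity
  have hB : 0 ≤ ((1 + t 2 ^ 2 + (v 0 ^ 2 + v 1 ^ 2)) ^ 2)⁻¹ := by positivity
  rw [bDensity_blocks_eq, ← ENNReal.ofReal_mul hA, ← ENNReal.ofReal_mul (mul_nonneg hA hB)]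
  refine ENNReal.ofReal_le_ofReal ?_
  have h1 : ((1 + δ ^ 2)⁻¹) ^ 2 ≤ 1 := by
    have : (1 + δ ^ 2)⁻¹ ≤ 1 := inv_le_one_of_one_le₀ (by nlinarith [sq_nonneg δ])
    have h0 : 0 ≤ (1 + δ ^ 2)⁻¹ := by positivity
    nlinarith
  have hw : 0 ≤ gnomonicWeight z := (Gnomonic.gnomonicWeight_pos z).le
  have hp1 : piWeight F ≤ 1 := piWeight_le_one F
  have hp0 : 0 ≤ piWeight F := (piWeight_pos F).le
  have hABw : 0 ≤ ((1 + t 1 ^ 2 + (u.1 ^ 2 + u.2 ^ 2)) ^ 2)⁻¹ * (((1 + t 2 ^ 2 + (v 0 ^ 2 + v 1 ^ 2)) ^ 2)⁻¹ * gnomonicWeight z) := mul_nonneg hA (mul_nonneg hB hw)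
  calc ((1 + δ ^ 2)⁻¹) ^ 2 * (((1 + t 1 ^ 2 + (u.1 ^ 2 + u.2 ^ 2)) ^ 2)⁻¹ * (((1 + t 2 ^ 2 + (v 0 ^ 2 + v 1 ^ 2)) ^ 2)⁻¹ * (gnomonicWeight z * piWeight F)))
      = (((1 + δ ^ 2)⁻¹) ^ 2 * piWeight F) * (((1 + t 1 ^ 2 + (u.1 ^ 2 + u.2 ^ 2)) ^ 2)⁻¹ * (((1 + t 2 ^ 2 + (v 0 ^ 2 + v 1 ^ 2)) ^ 2)⁻¹ * gnomonicWeight z)) := by ring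
    _ ≤ 1 * (((1 + t 1 ^ 2 + (u.1 ^ 2 + u.2 ^ 2)) ^ 2)⁻¹ * (((1 + t 2 ^ 2 + (v 0 ^ 2 + v 1 ^ 2)) ^ 2)⁻¹ * gnomonicWeight z)) :=
        mul_le_mul_of_nonneg_right (by nlinarith) hABw
    _ = _ := by ring

/-- ★ **THE EXPONENTIAL THREE-LETTER FLOOR**: for `δ² ≤ 1/3`, `u₁²+u₂² ≤ 1+x₀²`, `0 ≤ c` and ANY followers `F₀`,
`e^{−(c·55200L⁶)·F̂(hubAt δ 1, ε, η)} ≤ e^{−c·B₀|u|²/(1+x₀²+|u|²)}·e^{−c·|y⊥|²/(1+y₀²+|y⊥|²)}·e^{−c·|z|²/(1+|z|²)}` (`η = (x, y, z, F₀)`). [cite: Luscher1983, §2] -/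
theorem endGauss_exp_three_floor (δ : ℝ) (hδ : δ ^ 2 ≤ 1 / 3) (ε : GnoSign L) (η : GnoCoord L) (hu : (η.1.1 1) ^ 2 + (η.1.1 2) ^ 2 ≤ 1 + (η.1.1 0) ^ 2)
    {c : ℝ} (hc : 0 ≤ c) :
    Real.exp (-(c * (55200 * (L : ℝ) ^ 6) * gnoDeficit (fun _ => false) (fun _ => 1) (hubAt δ 1) ε η)) ≤
      Real.exp (-(c * (16 * δ ^ 2 / (1 + δ ^ 2) + 8 * (η.1.1 0) ^ 2 / ((1 + (η.1.1 0) ^ 2) * (1 + δ ^ 2)) + 4 * (η.1.2 0) ^ 2 / (1 + (η.1.2 0) ^ 2)) *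
          ((η.1.1 1) ^ 2 + (η.1.1 2) ^ 2) / (1 + (η.1.1 0) ^ 2 + ((η.1.1 1) ^ 2 + (η.1.1 2) ^ 2)))) *
        Real.exp (-(c * ((η.1.2 1) ^ 2 + (η.1.2 2) ^ 2) / (1 + (η.1.2 0) ^ 2 + ((η.1.2 1) ^ 2 + (η.1.2 2) ^ 2)))) *
        Real.exp (-(c * normSq3 η.2.1 / (1 + normSq3 η.2.1))) := by
  have h := endGauss_three_floor (L := L) δ hδ ε η hu
  rw [← Real.exp_add, ← Real.exp_add]
  refine Real.exp_le_exp.2 ?_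
  have e : -(c * (16 * δ ^ 2 / (1 + δ ^ 2) + 8 * (η.1.1 0) ^ 2 / ((1 + (η.1.1 0) ^ 2) * (1 + δ ^ 2)) + 4 * (η.1.2 0) ^ 2 / (1 + (η.1.2 0) ^ 2)) *
          ((η.1.1 1) ^ 2 + (η.1.1 2) ^ 2) / (1 + (η.1.1 0) ^ 2 + ((η.1.1 1) ^ 2 + (η.1.1 2) ^ 2))) +
        -(c * ((η.1.2 1) ^ 2 + (η.1.2 2) ^ 2) / (1 + (η.1.2 0) ^ 2 + ((η.1.2 1) ^ 2 + (η.1.2 2) ^ 2))) +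
        -(c * normSq3 η.2.1 / (1 + normSq3 η.2.1)) =
      -(c * ((16 * δ ^ 2 / (1 + δ ^ 2) + 8 * (η.1.1 0) ^ 2 / ((1 + (η.1.1 0) ^ 2) * (1 + δ ^ 2)) + 4 * (η.1.2 0) ^ 2 / (1 + (η.1.2 0) ^ 2)) *
          ((η.1.1 1) ^ 2 + (η.1.1 2) ^ 2) / (1 + (η.1.1 0) ^ 2 + ((η.1.1 1) ^ 2 + (η.1.1 2) ^ 2)) +
        ((η.1.2 1) ^ 2 + (η.1.2 2) ^ 2) / (1 + (η.1.2 0) ^ 2 + ((η.1.2 1) ^ 2 + (η.1.2 2) ^ 2)) +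
        normSq3 η.2.1 / (1 + normSq3 η.2.1))) := by ring
  rw [e, neg_le_neg_iff]
  calc c * ((16 * δ ^ 2 / (1 + δ ^ 2) + 8 * (η.1.1 0) ^ 2 / ((1 + (η.1.1 0) ^ 2) * (1 + δ ^ 2)) + 4 * (η.1.2 0) ^ 2 / (1 + (η.1.2 0) ^ 2)) *
          ((η.1.1 1) ^ 2 + (η.1.1 2) ^ 2) / (1 + (η.1.1 0) ^ 2 + ((η.1.1 1) ^ 2 + (η.1.1 2) ^ 2)) +
        ((η.1.2 1) ^ 2 + (η.1.2 2) ^ 2) / (1 + (η.1.2 0) ^ 2 + ((η.1.2 1) ^ 2 + (η.1.2 2) ^ 2)) +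
        normSq3 η.2.1 / (1 + normSq3 η.2.1))
      ≤ c * (55200 * (L : ℝ) ^ 6 * gnoDeficit (fun _ => false) (fun _ => 1) (hubAt δ 1) ε η) := mul_le_mul_of_nonneg_left h hc
    _ = c * (55200 * (L : ℝ) ^ 6) * gnoDeficit (fun _ => false) (fun _ => 1) (hubAt δ 1) ε η := by ring

end Summit.QuantumFields.YangMills.Theorems.SwapVirialDeficit.BlowUpRing

end
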